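/-
Copyright (c) 2026. All rights reserved.
Released under Apache 2.0 license as described in the file LICENSE.
-/
import Mathlib
import HarnessLib
import Literature.MathematicalPhysics.QuantumLattice.GaugeGroups
import Literature.MathematicalPhysics.QuantumFieldTheory.ConstructiveQFTWave0
import Literature.MathematicalPhysics.QuantumFieldTheory.LatticeGaugeProofs
import Literature.MathematicalPhysics.QuantumFieldTheory.U1GinibreComparison
import Literature.MathematicalPhysics.QuantumLattice.AbelianFieldTensor
import Literature.MathematicalPhysics.QuantumLattice.AbelianMagneticFlux
import Summits.Ventures.LatticeQCDFlow.Exactness.SymmetricMetropolis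
import Summits.Ventures.LatticeQCDFlow.Exactness.CompactHaar
import Summits.Ventures.LatticeQCDFlow.Scaling.LatticePeeling
import Summits.Ventures.LatticeQCDFlow.Scaling.SliceTwistWitness
import Summits.Ventures.LatticeQCDFlow.Scaling.FluxTunnellingU1Explicit
import Summits.Ventures.LatticeQCDFlow.Scaling.BoxSpreadWitness
import Summits.Ventures.LatticeQCDFlow.Scaling.BoxTouch
import Summits.Ventures.LatticeQCDFlow.Scaling.FluxTunnellingU1MaxPlaquette
import Summits.Ventures.LatticeQCDFlow.Scaling.FluxInsertionKernel
import Summits.Ventures.LatticeQCDFlow.Scaling.FluxInsertionBox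
import Summits.Ventures.LatticeQCDFlow.Scaling.ConvolutionPowerCompensation
import Summits.Ventures.LatticeQCDFlow.Scaling.FluxInsertionSharpFloor
import Summits.Ventures.LatticeQCDFlow.Scaling.FluxInsertionSharpFloorInstances
import Summits.Ventures.LatticeQCDFlow.Scaling.FluxInsertionSharpRate
import Literature.MathematicalPhysics.QuantumFieldTheory.TorusFreeTransfer
import Summits.Ventures.LatticeQCDFlow.Scaling.FluxInsertionHeightIdentity
import Summits.Ventures.LatticeQCDFlow.Scaling.FluxInsertionHeightLaw
import Summits.Ventures.LatticeQCDFlow.Scaling.TorusPotential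
import Summits.Ventures.LatticeQCDFlow.Scaling.FluxInsertionHeightCeiling
import Summits.Ventures.LatticeQCDFlow.Scaling.SectorActionFloor

/-!
# The wrap rule and the charge jump of the block insertion on an arbitrary configuration (item 109a)

HONEST FRAMING: exact (Metropolis-corrected) sampling algorithms for lattice gauge theory;
figures of merit are autocorrelation/cost numbers at stated couplings and volumes; no
continuum-physics claim.

Venture `LatticeQCDFlow` (cell pub-lqcd), topic `Scaling`, FANOUT row 29 (theory2, gen-21), item 109a
(imports item 107b).  NEW WORK; nothing here is cited as a fact.  `U(1)` on the two-torus `(ℤ/L)²`,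
Wilson action `S = Σ_x (1 − cos F(x))` with `F(x) = F_{01}(x) ∈ (−π, π]` the principal plaquette angle,
Lüscher charge `Q = Σ_x F(x)/(2π) ∈ ℤ`, block spread `W = boxSpread l` (item 94: plaquette angle
`α_l = 2π/N` on the `N = (l−1)(l+3)` positions of the set `R`, `0` elsewhere).

Items 104–107 computed `S` and `Q` only for configurations with PRESCRIBED plaquettes.  The lower
bound on the min–max height (item 109b) needs them for an ARBITRARY `U` and for `W·U`:

* §1 (`wilsonAction_eq_sum_site` is the tree's, lean-1), `sum_abelianFieldTensor_eq`:
  `S(U) = Σ_x (1 − cos F_U(x))` and `Σ_x F_U(x) = 2π Q(U)` for every `U`.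
* §2 `#R = N`, `#Rᶜ = L² − N` (as naturals and as reals), `N·α_l = 2π`.
* §3 THE WRAP RULE `abelianFieldTensor_boxSpread_mul`:
  `F_{WU}(x) = F_U(x) + boxF(x) − 2π·[π < F_U(x) + boxF(x)]` — multiplying by `W` adds `α_l` to the
  plaquette angle on `R` and the principal branch wraps exactly at the positions of the WRAP SET
  `boxWraps l U = {x ∈ R | π − α_l < F_U(x)}`.
* §4 THE CHARGE JUMP `topCharge_boxSpread_mul`: `Q(WU) = Q(U) + 1 − #boxWraps`; hence
  `Q(WU) ≠ Q(U) ↔ #boxWraps ≠ 1`, and the partial sums over `R` and its complement: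
  `Σ_R F_{WU} = Σ_R F_U + 2π − 2π·#boxWraps`, `Σ_{Rᶜ} F_{WU} = Σ_{Rᶜ} F_U`.
* §5 the first consequence: two wraps cost `S(U) ≥ 2(1 + cos α_l)`
  (`wilsonAction_ge_of_two_le_card_boxWraps`).
-/

noncomputable section

open MeasureTheory Filter Topology Real
open scoped ENNReal
open Literature.MathematicalPhysics.QuantumFieldTheory Literature.MathematicalPhysics.QuantumLattice
open Summit.Ventures.LatticeQCDFlow.Exactness

namespace Summit.Ventures.LatticeQCDFlow.Theory2.Lattice.Flux

section Wrap

variable {l L : ℕ} [NeZero L]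

/-! ## §1 Action and charge of an arbitrary configuration -/

/-- Every site is the `natSite` of its coordinate representatives. [folklore] -/
theorem natSite_val_eq (x : Site 2 L) : natSite (L := L) ((x 0).val, (x 1).val) = x := by
  have h0 : ∀ q : ℕ × ℕ, natSite (L := L) q 0 = (q.1 : ZMod L) := fun q => if_pos rfl
  have h1 : ∀ q : ℕ × ℕ, natSite (L := L) q 1 = (q.2 : ZMod L) := fun q => if_neg (by decide)
  funext i
  fin_cases i
  · exact (h0 _).trans (ZMod.natCast_zmod_val (x 0))
  · exact (h1 _).trans (ZMod.natCast_zmod_val (x 1))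

-- LANDING NOTE (lean-1 GEN-6, custody, LEAD LINE 113 RT-30 (117)(d)): theory2's
-- `wilsonAction_eq_sum_one_sub_cos` is deleted here (identical to the tree's
-- `Flux.wilsonAction_eq_sum_site`, `Scaling/SectorActionFloor.lean` p320451, imported above);
-- its former call sites below use `wilsonAction_eq_sum_site`.

/-- **`Σ_x F_U(x) = 2π Q(U)`** for every `U(1)` configuration on the two-torus. [folklore] -/
theorem sum_abelianFieldTensor_eq (U : GaugeConfig 2 L Circle) :
    ∑ x : Site 2 L, abelianFieldTensor U x 0 1 = 2 * π * topCharge (0 : Site 2 L) 0 1 U := by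
  have hg : ∀ x : Site 2 L, abelianFieldTensor U x 0 1 =
      abelianFieldTensor U (natSite (L := L) ((x 0).val, (x 1).val)) 0 1 := by
    intro x
    rw [natSite_val_eq]
  rw [topCharge_of_fieldTensor (g := fun a b => abelianFieldTensor U (natSite (L := L) (a, b)) 0 1) hg,
    ← sum_site_val_eq (fun a b => abelianFieldTensor U (natSite (L := L) (a, b)) 0 1)]
  simp only [natSite_val_eq]
  field_simp

omit [NeZero L] in
/-- The Wilson action is non-negative termwise: `0 ≤ 1 − cos F`. [folklore] -/
theorem one_sub_cos_abelianFieldTensor_nonneg (U : GaugeConfig 2 L Circle) (x : Site 2 L) :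
    0 ≤ 1 - Real.cos (abelianFieldTensor U x 0 1) :=
  sub_nonneg.mpr (Real.cos_le_one _)

/-! ## §2 Cardinalities -/

/-- `#R = (l−1)(l+3)` as a real number. [folklore] -/
theorem card_boxSites_real (hl : 2 ≤ l) (hlL : l + 1 ≤ L) :
    ((boxSites l L).card : ℝ) = ((l : ℝ) - 1) * ((l : ℝ) + 3) := by
  rw [card_boxSites hl hlL, natCast_boxN hl]

/-- `#Rᶜ = L² − N`. [folklore] -/
theorem card_compl_boxSites (hl : 2 ≤ l) (hlL : l + 1 ≤ L) :
    ((boxSites l L)ᶜ).card = L ^ 2 - ((l + 1) * (l + 1) - 4) := by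
  rw [Finset.card_compl, card_boxSites hl hlL]
  have hV : Fintype.card (Site 2 L) = L ^ 2 := by simp [ZMod.card, Fintype.card_fin]
  rw [hV]

/-- `#Rᶜ = L² − (l−1)(l+3)` as a real number. [folklore] -/
theorem card_compl_boxSites_real (hl : 2 ≤ l) (hlL : l + 1 ≤ L) :
    (((boxSites l L)ᶜ).card : ℝ) = (L : ℝ) ^ 2 - ((l : ℝ) - 1) * ((l : ℝ) + 3) := by
  rw [card_compl_boxSites hl hlL, natCast_boxM hl hlL]

/-- `N·α_l = 2π`. [folklore] -/
theorem card_boxSites_mul_boxAlpha (hl : 2 ≤ l) (hlL : l + 1 ≤ L) :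
    ((boxSites l L).card : ℝ) * boxAlpha l = 2 * π := by
  rw [card_boxSites_real hl hlL]
  obtain ⟨h1, h2⟩ := boxDen_ne_zero hl
  unfold boxAlpha
  field_simp

/-! ## §3 The wrap rule -/

/-- Plaquettes of `W·U`: `P_{WU}(x) = e^{i(F_U(x) + boxF(x))}`. [folklore] -/
theorem plaquetteHolonomy_boxSpread_mul (hl : 2 ≤ l) (hlL : l + 1 ≤ L) (U : GaugeConfig 2 L Circle)
    (x : Site 2 L) :
    plaquetteHolonomy (boxSpread l * U) x 0 1 =
      Circle.exp (abelianFieldTensor U x 0 1 + boxF l (x 0).val (x 1).val) := by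
  rw [plaquetteHolonomy_mul', plaquetteHolonomy_boxSpread hl hlL, ← exp_abelianFieldTensor U x 0 1,
    ← Circle.exp_add, add_comm]

/-- **THE WRAP RULE**: `F_{WU}(x) = F_U(x) + boxF(x) − 2π·[π < F_U(x) + boxF(x)]`. [folklore] -/
theorem abelianFieldTensor_boxSpread_mul (hl : 2 ≤ l) (hlL : l + 1 ≤ L) (U : GaugeConfig 2 L Circle)
    (x : Site 2 L) :
    abelianFieldTensor (boxSpread l * U) x 0 1 =
      abelianFieldTensor U x 0 1 + boxF l (x 0).val (x 1).val -
        (if π < abelianFieldTensor U x 0 1 + boxF l (x 0).val (x 1).val then 2 * π else 0) := by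
  have hF1 := neg_pi_lt_abelianFieldTensor U x 0 1
  have hF2 := abelianFieldTensor_le_pi U x 0 1
  have hb0 := boxF_nonneg hl (x 0).val (x 1).val
  have hb1 := boxF_le hl (x 0).val (x 1).val
  have hα := boxAlpha_lt_pi hl
  have hP := plaquetteHolonomy_boxSpread_mul hl hlL U x
  split_ifs with hw
  · refine abelianFieldTensor_eq_of_plaquette_eq_exp ?_ (by linarith) (by linarith)
    rw [hP]
    exact (Circle.exp_sub_two_pi _).symm
  · rw [sub_zero]
    exact abelianFieldTensor_eq_of_plaquette_eq_exp hP (by linarith) (not_lt.mp hw)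

variable (l) in
/-- The WRAP SET of `U`: the positions of `R` where adding `α_l` leaves the principal branch. [folklore] -/
def boxWraps (U : GaugeConfig 2 L Circle) : Finset (Site 2 L) :=
  (boxSites l L).filter fun x => π - boxAlpha l < abelianFieldTensor U x 0 1

/-- Membership in the wrap set. [folklore] -/
theorem mem_boxWraps {U : GaugeConfig 2 L Circle} {x : Site 2 L} :
    x ∈ boxWraps l U ↔ inR l (x 0).val (x 1).val ∧ π - boxAlpha l < abelianFieldTensor U x 0 1 := by
  simp [boxWraps, mem_boxSites]

/-- The wrap indicator is the indicator of the wrap set. [folklore] -/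
theorem wrap_iff_mem_boxWraps (U : GaugeConfig 2 L Circle) (x : Site 2 L) :
    π < abelianFieldTensor U x 0 1 + boxF l (x 0).val (x 1).val ↔ x ∈ boxWraps l U := by
  rw [mem_boxWraps]
  by_cases hx : inR l (x 0).val (x 1).val
  · rw [boxF_of_inR hx]
    constructor
    · exact fun h => ⟨hx, by linarith⟩
    · exact fun h => by linarith [h.2]
  · rw [boxF_of_not_inR hx, add_zero]
    constructor
    · exact fun h => absurd (abelianFieldTensor_le_pi U x 0 1) (not_le.mpr h)
    · exact fun h => absurd h.1 hx

/-- The wrap rule on the wrap set: `F_{WU} = F_U + α_l − 2π`. [folklore] -/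
theorem abelianFieldTensor_boxSpread_mul_of_mem (hl : 2 ≤ l) (hlL : l + 1 ≤ L)
    {U : GaugeConfig 2 L Circle} {x : Site 2 L} (hx : x ∈ boxWraps l U) :
    abelianFieldTensor (boxSpread l * U) x 0 1 = abelianFieldTensor U x 0 1 + boxAlpha l - 2 * π := by
  rw [abelianFieldTensor_boxSpread_mul hl hlL, if_pos ((wrap_iff_mem_boxWraps U x).mpr hx),
    boxF_of_inR (mem_boxWraps.mp hx).1]

/-- The wrap rule off the wrap set: `F_{WU} = F_U + boxF`. [folklore] -/
theorem abelianFieldTensor_boxSpread_mul_of_not_mem (hl : 2 ≤ l) (hlL : l + 1 ≤ L)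
    {U : GaugeConfig 2 L Circle} {x : Site 2 L} (hx : x ∉ boxWraps l U) :
    abelianFieldTensor (boxSpread l * U) x 0 1 =
      abelianFieldTensor U x 0 1 + boxF l (x 0).val (x 1).val := by
  rw [abelianFieldTensor_boxSpread_mul hl hlL,
    if_neg (fun h => hx ((wrap_iff_mem_boxWraps U x).mp h)), sub_zero]

/-! ## §4 The charge jump -/

/-- `Σ_x 2π·[wrap] = 2π·#boxWraps`. [folklore] -/
theorem sum_wrap_indicator (U : GaugeConfig 2 L Circle) :
    ∑ x : Site 2 L, (if π < abelianFieldTensor U x 0 1 + boxF l (x 0).val (x 1).val then 2 * π else 0)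
      = 2 * π * (boxWraps l U).card := by
  have hfilter : (Finset.univ.filter fun x : Site 2 L =>
      π < abelianFieldTensor U x 0 1 + boxF l (x 0).val (x 1).val) = boxWraps l U := by
    ext x
    simp only [Finset.mem_filter, Finset.mem_univ, true_and]
    exact wrap_iff_mem_boxWraps U x
  rw [← Finset.sum_filter, hfilter, Finset.sum_const, nsmul_eq_mul, mul_comm]

/-- **THE CHARGE JUMP**: `Q(WU) = Q(U) + 1 − #boxWraps(U)`. [folklore] -/
theorem topCharge_boxSpread_mul (hl : 2 ≤ l) (hlL : l + 1 ≤ L) (U : GaugeConfig 2 L Circle) :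
    topCharge (0 : Site 2 L) 0 1 (boxSpread l * U) =
      topCharge (0 : Site 2 L) 0 1 U + 1 - (boxWraps l U).card := by
  have h1 := sum_abelianFieldTensor_eq (boxSpread l * U)
  simp only [abelianFieldTensor_boxSpread_mul hl hlL U, Finset.sum_sub_distrib,
    Finset.sum_add_distrib, sum_abelianFieldTensor_eq U, sum_boxF_site hl hlL,
    sum_wrap_indicator U] at h1
  have hπ : (2 * π : ℝ) ≠ 0 := by positivity
  have h2 : 2 * π * topCharge (0 : Site 2 L) 0 1 (boxSpread l * U) =
      2 * π * (topCharge (0 : Site 2 L) 0 1 U + 1 - (boxWraps l U).card) := by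
    rw [← h1]; ring
  exact mul_left_cancel₀ hπ h2

/-- **The charge changes iff the number of wraps is not one.** [folklore] -/
theorem topCharge_boxSpread_mul_ne_iff (hl : 2 ≤ l) (hlL : l + 1 ≤ L) (U : GaugeConfig 2 L Circle) :
    topCharge (0 : Site 2 L) 0 1 (boxSpread l * U) ≠ topCharge (0 : Site 2 L) 0 1 U ↔
      (boxWraps l U).card ≠ 1 := by
  rw [topCharge_boxSpread_mul hl hlL U]
  constructor
  · intro h hk
    apply h
    rw [hk]
    push_cast
    ring
  · intro hk h
    apply hk
    have h' : ((boxWraps l U).card : ℝ) = 1 := by linarith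
    exact_mod_cast h'

/-- The `R`-sum after the insertion: `Σ_R F_{WU} = Σ_R F_U + 2π − 2π·#boxWraps`. [folklore] -/
theorem sum_boxSites_abelianFieldTensor_boxSpread_mul (hl : 2 ≤ l) (hlL : l + 1 ≤ L)
    (U : GaugeConfig 2 L Circle) :
    ∑ x ∈ boxSites l L, abelianFieldTensor (boxSpread l * U) x 0 1 =
      ∑ x ∈ boxSites l L, abelianFieldTensor U x 0 1 + 2 * π - 2 * π * (boxWraps l U).card := by
  have hsub : boxWraps l U ⊆ boxSites l L := Finset.filter_subset _ _
  have hsplit : ∀ f : Site 2 L → ℝ, ∑ x ∈ boxSites l L, f x =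
      ∑ x ∈ boxWraps l U, f x + ∑ x ∈ boxSites l L \ boxWraps l U, f x := fun f =>
    (Finset.sum_sdiff hsub).symm.trans (add_comm _ _)
  have hW : ∀ x ∈ boxWraps l U, abelianFieldTensor (boxSpread l * U) x 0 1 =
      abelianFieldTensor U x 0 1 + boxAlpha l - 2 * π := fun x hx =>
    abelianFieldTensor_boxSpread_mul_of_mem hl hlL hx
  have hO : ∀ x ∈ boxSites l L \ boxWraps l U, abelianFieldTensor (boxSpread l * U) x 0 1 =
      abelianFieldTensor U x 0 1 + boxAlpha l := by
    intro x hx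
    rw [Finset.mem_sdiff] at hx
    rw [abelianFieldTensor_boxSpread_mul_of_not_mem hl hlL hx.2, boxF_of_inR (mem_boxSites.mp hx.1)]
  have hcard : ((boxSites l L \ boxWraps l U).card : ℝ) =
      (boxSites l L).card - (boxWraps l U).card := by
    rw [eq_sub_iff_add_eq]
    exact_mod_cast Finset.card_sdiff_add_card_eq_card hsub
  rw [hsplit, hsplit (fun x => abelianFieldTensor U x 0 1), Finset.sum_congr rfl hW,
    Finset.sum_congr rfl hO, Finset.sum_sub_distrib, Finset.sum_add_distrib, Finset.sum_add_distrib,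
    Finset.sum_const, Finset.sum_const, Finset.sum_const, nsmul_eq_mul, nsmul_eq_mul, nsmul_eq_mul,
    hcard]
  linear_combination card_boxSites_mul_boxAlpha hl hlL

/-- The `Rᶜ`-sum is unchanged by the insertion: `Σ_{Rᶜ} F_{WU} = Σ_{Rᶜ} F_U`. [folklore] -/
theorem sum_compl_boxSites_abelianFieldTensor_boxSpread_mul (hl : 2 ≤ l) (hlL : l + 1 ≤ L)
    (U : GaugeConfig 2 L Circle) :
    ∑ x ∈ (boxSites l L)ᶜ, abelianFieldTensor (boxSpread l * U) x 0 1 =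
      ∑ x ∈ (boxSites l L)ᶜ, abelianFieldTensor U x 0 1 := by
  refine Finset.sum_congr rfl fun x hx => ?_
  rw [Finset.mem_compl, mem_boxSites] at hx
  have hx' : x ∉ boxWraps l U := fun h => hx (mem_boxWraps.mp h).1
  rw [abelianFieldTensor_boxSpread_mul_of_not_mem hl hlL hx', boxF_of_not_inR hx, add_zero]

/-- The two partial sums of `F_U` add up to `2πQ(U)`. [folklore] -/
theorem sum_boxSites_add_sum_compl (U : GaugeConfig 2 L Circle) :
    ∑ x ∈ boxSites l L, abelianFieldTensor U x 0 1 +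
        ∑ x ∈ (boxSites l L)ᶜ, abelianFieldTensor U x 0 1 =
      2 * π * topCharge (0 : Site 2 L) 0 1 U := by
  rw [Finset.sum_add_sum_compl, sum_abelianFieldTensor_eq]

/-! ## §5 The cost of two wraps -/

/-- **Two wraps are expensive**: if `#boxWraps(U) ≥ 2` then `S(U) ≥ 2(1 + cos α_l)` (each wrapping
plaquette has `F_U > π − α_l`, hence `1 − cos F_U ≥ 1 + cos α_l`). [folklore] -/
theorem wilsonAction_ge_of_two_le_card_boxWraps (hl : 2 ≤ l) {U : GaugeConfig 2 L Circle}
    (hk : 2 ≤ (boxWraps l U).card) : 2 * (1 + Real.cos (boxAlpha l)) ≤ wilsonAction u1Rep U := by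
  have hα := boxAlpha_pos hl
  have hαπ := boxAlpha_lt_pi hl
  have hc : 0 ≤ 1 + Real.cos (boxAlpha l) := by linarith [Real.neg_one_le_cos (boxAlpha l)]
  rw [wilsonAction_eq_sum_site]
  calc 2 * (1 + Real.cos (boxAlpha l))
      ≤ ((boxWraps l U).card : ℝ) * (1 + Real.cos (boxAlpha l)) :=
        mul_le_mul_of_nonneg_right (by exact_mod_cast hk) hc
    _ = ∑ x ∈ boxWraps l U, (1 + Real.cos (boxAlpha l)) := by
        rw [Finset.sum_const, nsmul_eq_mul]
    _ ≤ ∑ x ∈ boxWraps l U, (1 - Real.cos (abelianFieldTensor U x 0 1)) := by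
        refine Finset.sum_le_sum fun x hx => ?_
        have h1 := (mem_boxWraps.mp hx).2
        have h2 := abelianFieldTensor_le_pi U x 0 1
        have h3 : Real.cos (abelianFieldTensor U x 0 1) ≤ Real.cos (π - boxAlpha l) :=
          Real.cos_le_cos_of_nonneg_of_le_pi (by linarith) h2 h1.le
        rw [Real.cos_pi_sub] at h3
        linarith
    _ ≤ ∑ x : Site 2 L, (1 - Real.cos (abelianFieldTensor U x 0 1)) :=
        Finset.sum_le_sum_of_subset_of_nonneg (Finset.subset_univ _)
          fun x _ _ => one_sub_cos_abelianFieldTensor_nonneg U x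

end Wrap

end Summit.Ventures.LatticeQCDFlow.Theory2.Lattice.Flux

end
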